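import Mathlib
import HarnessLib
import Summits.BirchSwinnertonDyer.BirchSwinnertonDyer.Theorems.SylvesterTwoHeegnerIndexUnramifiedQuadraticOrders

/-!
# Route `SylvesterTwoHeegnerIndex` (rung K7t): the `ℤ₂[ω]`-linear algebra of ROAD (k), PART IV —
# HILBERT 90 on a cyclic `𝒪/2^N`-line: every conjugation-semilinear involution fixes an `𝒪`-generator

Cell `bsd-cm`, seat `bsd-cm-k7t-c2` (prover-bsd-cm-k7t-c2-g15-0; hand item 19229
`HeegnerIndexUpperAtTwoHSY`: verdict unchanged, NOT FOUND as a theorem — open as a class). PARTITION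
(D-0054): CornerF at `p = 2` (B14/O12) × 𝒞_HSY (`E_p : x³ + y³ = p`) × `p = 2` — types-the-object-of:
pin (e4) of desk (M-K3) (memo two = `HOME/MEMO-bsd-cm-two.md` v2.20 §66.3) for the `𝒪`-linear Kolyvagin
argument over `K = ℚ(ω)` at the inert prime `2` (ROAD (k); line card
`Cruxes/UpperOffV0HSYPlus/Lines/cmframe-kolyvagin2.md`, skeleton of record VARIANT J
`Cruxes/UpperOffV0HSYPlus/Lines/coupled_variantJ.lean`, stub (K3-4)), continuing Parts I–III
(`…UnramifiedQuadraticDescent` p553247, `…Pairings` p571041, `…Orders` p576537). Kernel helper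
`--supports stmt-BirchSwinnertonDyer-19804 --as helper` (planner D331/D332: pre-authorised (H90) task);
closes no cell and no item; BSD is not claimed; THEOREM K3 stays a PAPER theorem. Everything is PROVED
abstract algebra over Mathlib in the (M, w, σ)-encoding of Parts I–III — NO ring carrier for `𝒪/2^N` is
introduced: no definition, no named fact, no instance, no notation, no `sorry`.

SETTING: `M` an additive group, `w : M →+ M` with `w² + w + 1 = 0`; a CYCLIC `𝒪/2^N`-LINE = a generator
`e` (`∀ x, ∃ m n : ℤ, x = m • e + n • w e`) with `2^N e = 0` and `2^k e = 0 → N ≤ k`; a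
CONJUGATION-SEMILINEAR INVOLUTION = `σ : M →+ M` with `σ² = id`, `σ w = w̄ σ` (`w̄ = −1 − w`).

WHAT IS PROVED, AND WHERE ROAD (k) USES IT.
* §A INTEGER HILBERT 90 FOR `𝒪/2^M` (`hilbert90_coeffs`): if `a² − ab + b² ≡ 1 (mod 2^M)`, `M ≥ 1`
  (i.e. `α = a + bω` has norm one in `𝒪/2^M`), there are `c, d` NOT BOTH EVEN (i.e. `β = c + dω` a
  unit, Part III `generator_of_not_two_dvd`) with `α·β̄ ≡ β (mod 2^M)`, i.e. `α = β/β̄`: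
  explicit witnesses `β = 1 + α` (when `b` is odd) and `β = ω + αω̄` (when `b` is even) — the
  Lagrange-resolvent proof of Hilbert 90 for the cyclic group `Gal(K/ℚ)` acting on the units of the
  Galois ring `𝒪/2^M = ℤ/2^M[ω]`, made effective by the residue field `𝔽₄`.
* §B MODULE FORM = H90 PROPER (`exists_invariant_generator`): on a cyclic `𝒪/2^N`-line EVERY
  conjugation-semilinear involution `σ` FIXES an `𝒪`-GENERATOR. (`σ e = αe` with `N(α)e = σ²e = e` by
  Part III's norm identity, so `N(α) ≡ 1` by freeness; then `s := βe` works.) Equivalently: all such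
  involutions are conjugate under the units; equivalently `H¹(⟨σ⟩, (𝒪/2^N)^×) = 0`.
* §C FIXED POINTS (`sigma_eq_self_iff_of_invariant_generator`): for an invariant generator `e`,
  `M^σ = ℤ·e` — `σ(a e + b ωe) = a e + b ωe ↔ 2^N ∣ b` (via Part I's `θ = 1 + 2ω` bijective); with
  Part I's descent `M = M^σ ⊕ ω M^σ` this is the concrete form «`((𝒪/2^M)^×)^{conj} = (ℤ/2^M)^×`».
USE (memo §66.3 (e4), §64.2 (C3)/(C4), Prop 3.1′ (1) and its converse in §65.1): `Frob_ℓ` (ℓ ∈ 𝒮₁(M))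
acts on the line `X[2^M] ≅ 𝒪/2^M` as a conjugation-semilinear involution (`φ_ℓ² = −ℓ ≡ 1`); H90 says it
is `τ` up to conjugation by a unit — «choose `𝔓` with `Frob(𝔓)|_{L^{(M)}} = τ` EXACTLY; other choices
change `φ` by a unit, immaterial for (C3)» — and §C is the memo's «fixed points of conjugation being
`(ℤ/2^M)^×` as `α − ᾱ = b(1 + 2ω)` with `1 + 2ω ∈ O₂^×`».

References: Hilbert, Zahlbericht §54 (Satz 90) — shape; the Galois-ring case `ℤ/2^M[ω] ⊃ ℤ/2^M` is
done by hand here. [McC91] W. G. McCallum, LMS LN 153 (1991) §3 (the choice of `λ_L`); memo two §66.3.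
-/

set_option autoImplicit false
set_option linter.dupNamespace false

namespace Summit.BirchSwinnertonDyer.BirchSwinnertonDyer.Theorems.SylvesterTwoUnramifiedHilbert90

open Summit.BirchSwinnertonDyer.BirchSwinnertonDyer.Theorems.SylvesterTwoUnramifiedDescent
open Summit.BirchSwinnertonDyer.BirchSwinnertonDyer.Theorems.SylvesterTwoUnramifiedPairings
open Summit.BirchSwinnertonDyer.BirchSwinnertonDyer.Theorems.SylvesterTwoUnramifiedOrders

/-! ### §A Integer Hilbert 90 for the Galois ring `𝒪/2^M = ℤ/2^M[ω]` -/

/-- A norm-one pair modulo `2^M` (`M ≥ 1`) is not divisible by `2`: `2^M ∣ a² − ab + b² − 1` forces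
`a, b` not both even. -/
theorem not_both_even_of_norm_one {M : ℕ} (hM : 1 ≤ M) {a b : ℤ}
    (h : (2 : ℤ) ^ M ∣ a ^ 2 - a * b + b ^ 2 - 1) : ¬ (2 ∣ a ∧ 2 ∣ b) := by
  rintro ⟨⟨a', rfl⟩, ⟨b', rfl⟩⟩
  have h2 : (2 : ℤ) ∣ (2 * a') ^ 2 - (2 * a') * (2 * b') + (2 * b') ^ 2 - 1 :=
    dvd_trans (dvd_pow_self 2 (by omega)) h
  obtain ⟨k, hk⟩ := h2
  have h1 : (1 : ℤ) = 2 * (2 * a' ^ 2 - 2 * a' * b' + 2 * b' ^ 2 - k) := by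
    linear_combination (-1 : ℤ) * hk
  have : (2 : ℤ) ∣ 1 := ⟨_, h1⟩
  omega

/-- **HILBERT 90 FOR `𝒪/2^M`, EXPLICIT.** If `α = a + bω` has norm `a² − ab + b² ≡ 1 (mod 2^M)`
(`M ≥ 1`), there is a UNIT `β = c + dω` of `𝒪/2^M` (`c, d` not both even) with `α·β̄ ≡ β`, i.e.
`(a + bω)((c − d) − dω) = (ac − ad + bd) + (bc − ad)ω ≡ c + dω (mod 2^M)`: so `α = β/β̄`, every
norm-one unit is a `σ`-coboundary. Witnesses: `β = 1 + α` if `b` is odd, `β = ω + αω̄ = (b − a) + (1 − a)ω`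
if `b` is even (then `a` is odd). [memo §66.3 (e4) «every norm-one element of `(O/2^M)^×` is `β̄/β`».] -/
theorem hilbert90_coeffs {M : ℕ} (hM : 1 ≤ M) {a b : ℤ}
    (h : (2 : ℤ) ^ M ∣ a ^ 2 - a * b + b ^ 2 - 1) :
    ∃ c d : ℤ, ¬ (2 ∣ c ∧ 2 ∣ d) ∧ (2 : ℤ) ^ M ∣ a * c - a * d + b * d - c ∧
      (2 : ℤ) ^ M ∣ b * c - a * d - d := by
  rcases Int.even_or_odd b with ⟨b', hb⟩ | hb
  · -- `b` even, hence `a` odd: `β = ω + αω̄ = (b − a) + (1 − a)ω`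
    have ha : ¬ 2 ∣ a := fun ha => not_both_even_of_norm_one hM h ⟨ha, ⟨b', by rw [hb]; ring⟩⟩
    refine ⟨b - a, 1 - a, fun ⟨hc, _⟩ => ha (by omega), ⟨0, by ring⟩, ?_⟩
    obtain ⟨k, hk⟩ := h
    exact ⟨k, by linear_combination hk⟩
  · -- `b` odd: `β = 1 + α = (1 + a) + bω`
    refine ⟨1 + a, b, fun ⟨_, hd⟩ => ?_, ?_, ⟨0, by ring⟩⟩
    · obtain ⟨b', hb'⟩ := hb
      omega
    · obtain ⟨k, hk⟩ := h
      exact ⟨k, by linear_combination hk⟩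

/-! ### §B Hilbert 90 on a cyclic `𝒪/2^N`-line: every semilinear involution fixes a generator -/

variable {M : Type*} [AddCommGroup M]

/-- `σ` twice on `x = a e + b ωe` when `σ e = x`: `σ x = (a − b)·x − b·ωx`. -/
theorem sigma_span_eq (w σ : M →+ M) (hσw : ∀ x, σ (w x) = -(σ x) - w (σ x)) (e : M) (a b : ℤ) :
    σ (a • e + b • w e) = (a - b) • σ e - b • w (σ e) := by
  rw [map_add, map_zsmul, map_zsmul, hσw]
  module

/-- NORM ONE: if `σ` is a conjugation-semilinear involution on a cyclic `𝒪/2^N`-line with generator `e`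
and `σ e = a e + b ωe`, then `2^N ∣ a² − ab + b² − 1` (`σ² e = N(a + bω)·e` by Part III's norm
identity, `= e`, and the line is free). -/
theorem two_pow_dvd_norm_sub_one (w σ : M →+ M) (hw : ∀ x, w (w x) + w x + x = 0)
    (hσ : ∀ x, σ (σ x) = x) (hσw : ∀ x, σ (w x) = -(σ x) - w (σ x)) {N : ℕ} {e : M}
    (he : ∀ x : M, ∃ m n : ℤ, x = m • e + n • w e) (hN : (2 : ℤ) ^ N • e = 0)
    (hmin : ∀ k : ℕ, (2 : ℤ) ^ k • e = 0 → N ≤ k) {a b : ℤ} (hab : σ e = a • e + b • w e) :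
    (2 : ℤ) ^ N ∣ a ^ 2 - a * b + b ^ 2 - 1 := by
  have key : (a ^ 2 - a * b + b ^ 2 - 1) • e + (0 : ℤ) • w e = 0 := by
    rw [zero_smul, add_zero, sub_smul, one_smul, ← norm_smul_eq w hw e a b, ← hab,
      ← sigma_span_eq w σ hσw e a b, ← hab, hσ, sub_self]
  exact ((smul_add_smul_w_eq_zero_iff w hw he hN hmin _ _).mp key).1

/-- `σ` of a general element `c e + d ωe` when `σ e = a e + b ωe`:
`σ(c e + d ωe) = (ac − ad + bd) e + (bc − ad) ωe` — the product `(a + bω)·conj(c + dω)` in `𝒪`. -/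
theorem sigma_apply_span (w σ : M →+ M) (hw : ∀ x, w (w x) + w x + x = 0)
    (hσw : ∀ x, σ (w x) = -(σ x) - w (σ x)) {e : M} {a b : ℤ} (hab : σ e = a • e + b • w e)
    (c d : ℤ) :
    σ (c • e + d • w e) = (a * c - a * d + b * d) • e + (b * c - a * d) • w e := by
  rw [sigma_span_eq w σ hσw e c d, hab]
  simp only [map_add, map_zsmul, w_w_eq w hw]
  module

/-- **HILBERT 90 ON A CYCLIC `𝒪/2^N`-LINE.** Every conjugation-semilinear involution `σ` of a cyclic
`𝒪/2^N`-line (`σ² = id`, `σω = ω̄σ`) FIXES an `𝒪`-GENERATOR: `∃ s, σ s = s ∧ M = 𝒪·s`. Equivalently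
all such involutions are conjugate to one another by units of `𝒪/2^N`, i.e. `H¹(⟨σ⟩, (𝒪/2^N)^×) = 0`.
[memo §66.3 (e4): `Frob_ℓ` on `X[2^M] ≅ O/2^M` IS `τ` up to a unit — «choose `𝔓` with
`Frob(𝔓)|_{L^{(M)}} = τ` EXACTLY»; §64.2 (C4) `X[2^M] = O·P_ℝ` with `τ(αP_ℝ) = ᾱP_ℝ`.] -/
theorem exists_invariant_generator (w σ : M →+ M) (hw : ∀ x, w (w x) + w x + x = 0)
    (hσ : ∀ x, σ (σ x) = x) (hσw : ∀ x, σ (w x) = -(σ x) - w (σ x)) {N : ℕ} {e : M}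
    (he : ∀ x : M, ∃ m n : ℤ, x = m • e + n • w e) (hN : (2 : ℤ) ^ N • e = 0)
    (hmin : ∀ k : ℕ, (2 : ℤ) ^ k • e = 0 → N ≤ k) :
    ∃ s : M, σ s = s ∧ ∀ x : M, ∃ m n : ℤ, x = m • s + n • w s := by
  rcases Nat.eq_zero_or_pos N with hN0 | hNpos
  · -- the zero line: `e = 0`
    subst hN0
    rw [pow_zero, one_smul] at hN
    refine ⟨e, by rw [hN, map_zero], he⟩
  · obtain ⟨a, b, hab⟩ := he (σ e)
    obtain ⟨c, d, hcd, h1, h2⟩ :=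
      hilbert90_coeffs hNpos (two_pow_dvd_norm_sub_one w σ hw hσ hσw he hN hmin hab)
    refine ⟨c • e + d • w e, ?_, ?_⟩
    · -- `σ s − s = (2^N-multiples) • e + (2^N-multiples) • ωe = 0`
      rw [sigma_apply_span w σ hw hσw hab, ← sub_eq_zero]
      have e0 : (a * c - a * d + b * d) • e + (b * c - a * d) • w e - (c • e + d • w e) =
          (a * c - a * d + b * d - c) • e + (b * c - a * d - d) • w e := by module
      rw [e0]
      exact (smul_add_smul_w_eq_zero_iff w hw he hN hmin _ _).mpr ⟨h1, h2⟩
    · -- `s` is a generator: `c, d` not both even (Part III)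
      obtain ⟨m', n', he'⟩ := generator_of_not_two_dvd w hw hN hcd
      intro x
      obtain ⟨m₁, n₁, hx⟩ := he x
      exact ⟨_, _, span_trans w hw he' hx⟩

/-! ### §C Fixed points: `M^σ = ℤ·e` for an invariant generator `e` -/

/-- `σ(a e + b ωe) = (a − b) e − b ωe` when `σ e = e`. -/
theorem sigma_apply_of_invariant (w σ : M →+ M) (hσw : ∀ x, σ (w x) = -(σ x) - w (σ x)) {e : M}
    (hσe : σ e = e) (a b : ℤ) : σ (a • e + b • w e) = (a - b) • e - b • w e := by
  rw [sigma_span_eq w σ hσw e a b, hσe]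

/-- **FIXED POINTS OF CONJUGATION = the `ℤ/2^N`-line of the invariant generator**: on a cyclic
`𝒪/2^N`-line with invariant generator `e` (`σ e = e`), `σ(a e + b ωe) = a e + b ωe ↔ 2^N ∣ b`
(the difference is `−b·θe`, `θ = 1 + 2ω` is a unit — Part I `theta_bijective` — and the line is free).
[memo §66.3 (e4): «fixed points of conjugation being `(ℤ/2^M)^×`, as `α − ᾱ = b(1 + 2ω)` with
`1 + 2ω ∈ O₂^×`».] -/
theorem sigma_eq_self_iff_of_invariant_generator (w σ : M →+ M) (hw : ∀ x, w (w x) + w x + x = 0)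
    (hσw : ∀ x, σ (w x) = -(σ x) - w (σ x)) {N : ℕ} {e : M}
    (he : ∀ x : M, ∃ m n : ℤ, x = m • e + n • w e) (hN : (2 : ℤ) ^ N • e = 0)
    (hmin : ∀ k : ℕ, (2 : ℤ) ^ k • e = 0 → N ≤ k) (hσe : σ e = e) (a b : ℤ) :
    σ (a • e + b • w e) = a • e + b • w e ↔ (2 : ℤ) ^ N ∣ b := by
  rw [sigma_apply_of_invariant w σ hσw hσe, ← sub_eq_zero]
  have e0 : (a - b) • e - b • w e - (a • e + b • w e) = -((b • e) + 2 • w (b • e)) := by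
    rw [map_zsmul]; module
  rw [e0, neg_eq_zero]
  constructor
  · intro h0
    -- `θ (b • e) = 0 ⇒ b • e = 0` (`θ` injective since `3` is bijective on the `2`-primary line)
    have h3 : Function.Bijective fun x : M => (3 : ℤ) • x :=
      three_zsmul_bijective_of_two_primary fun x => ⟨N, two_pow_smul_eq_zero_of_generator w he hN x⟩
    have hb : b • e = 0 := by
      have := (theta_bijective w hw h3).injective (a₁ := b • e) (a₂ := 0) (by simpa using h0)
      exact this
    have := (smul_add_smul_w_eq_zero_iff w hw he hN hmin b 0).mp (by rw [zero_smul, add_zero, hb])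
    exact this.1
  · rintro ⟨b', rfl⟩
    rw [mul_comm, mul_smul, hN, smul_zero, map_zero, smul_zero, add_zero]

/-- Hence the invariants are EXACTLY the `ℤ`-multiples of the invariant generator:
`σ x = x ↔ ∃ a : ℤ, x = a • e`. [memo §64.2 (C4)/(e4): `S = S^τ ⊗ O`, `S^τ` a `ℤ/2^M`-line.] -/
theorem sigma_eq_self_iff_exists_zsmul (w σ : M →+ M) (hw : ∀ x, w (w x) + w x + x = 0)
    (hσw : ∀ x, σ (w x) = -(σ x) - w (σ x)) {N : ℕ} {e : M}
    (he : ∀ x : M, ∃ m n : ℤ, x = m • e + n • w e) (hN : (2 : ℤ) ^ N • e = 0)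
    (hmin : ∀ k : ℕ, (2 : ℤ) ^ k • e = 0 → N ≤ k) (hσe : σ e = e) (x : M) :
    σ x = x ↔ ∃ a : ℤ, x = a • e := by
  obtain ⟨a, b, rfl⟩ := he x
  rw [sigma_eq_self_iff_of_invariant_generator w σ hw hσw he hN hmin hσe]
  constructor
  · rintro ⟨b', rfl⟩
    exact ⟨a, by rw [mul_comm, mul_smul, ← map_zsmul w, hN, map_zero, smul_zero, add_zero]⟩
  · rintro ⟨a', ha'⟩
    -- `a e + b ωe = a' e` forces `2^N ∣ b` by freeness
    have h0 : (a - a') • e + b • w e = 0 := by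
      rw [sub_smul, sub_add_eq_add_sub, ha', sub_self]
    exact ((smul_add_smul_w_eq_zero_iff w hw he hN hmin _ _).mp h0).2

/-- **TWO SEMILINEAR INVOLUTIONS, TWO INVARIANT GENERATORS, ONE SCALAR BETWEEN THEM.** Two
conjugation-semilinear involutions `σ, σ'` of the same cyclic `𝒪/2^N`-line fix `𝒪`-generators `s, s'`,
and `s' = u·s` for a scalar `u = m + nω` (a unit of `𝒪/2^N`, both being generators): conjugating by `u`
carries `σ` (`αs ↦ ᾱs`) to `σ'` (`αs' ↦ ᾱs'`) — H90 in its «all such involutions are conjugate» form,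
recorded in the encoding's terms. [memo §66.3 (e4): «other choices change `φ` by a unit ((C2)),
immaterial for (C3)».] -/
theorem exists_invariant_generators_pair (w σ σ' : M →+ M) (hw : ∀ x, w (w x) + w x + x = 0)
    (hσ : ∀ x, σ (σ x) = x) (hσw : ∀ x, σ (w x) = -(σ x) - w (σ x))
    (hσ' : ∀ x, σ' (σ' x) = x) (hσ'w : ∀ x, σ' (w x) = -(σ' x) - w (σ' x)) {N : ℕ} {e : M}
    (he : ∀ x : M, ∃ m n : ℤ, x = m • e + n • w e) (hN : (2 : ℤ) ^ N • e = 0)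
    (hmin : ∀ k : ℕ, (2 : ℤ) ^ k • e = 0 → N ≤ k) :
    ∃ s s' : M, σ s = s ∧ σ' s' = s' ∧ (∀ x : M, ∃ m n : ℤ, x = m • s + n • w s) ∧
      (∀ x : M, ∃ m n : ℤ, x = m • s' + n • w s') ∧ ∃ m n : ℤ, s' = m • s + n • w s := by
  obtain ⟨s, hs, hgen⟩ := exists_invariant_generator w σ hw hσ hσw he hN hmin
  obtain ⟨s', hs', hgen'⟩ := exists_invariant_generator w σ' hw hσ' hσ'w he hN hmin
  exact ⟨s, s', hs, hs', hgen, hgen', hgen s'⟩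

end Summit.BirchSwinnertonDyer.BirchSwinnertonDyer.Theorems.SylvesterTwoUnramifiedHilbert90
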